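import Summits.BirchSwinnertonDyer.Rank1Residual.WAll.AltClosersGluePrimaryGZ
import Summits.BirchSwinnertonDyer.Rank1Residual.WAll.AltClosersResidualCells
import Summits.BirchSwinnertonDyer.Rank1Residual.WAll.TargetPrimeSlices
import HarnessLib

/-!
# Rung W-ALL (D-0120): the registry keyed to the PRIME / RANK SLICE LEAVES of rows 2 / 7 / 12i
# (`TargetPrimeSlices.lean`, gate5 closerlists 2026-08-27T06:17Z) — the slices from the rung leaves
# BY NAME, and W-ALL from the slices (cell `bsd-wall`, lane 2, seat ty-2; glue, Theses-free)

HONEST FRAMING (cell `bsd-wall`, run/shared/lean/pub/bsd-wall/; WALL-BRIEF-v1 §2). NOTHING ASSERTED: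
no `def`, no `@[conjecture]`, no named fact, no route file imported; W-ALL is OPEN and this file
proves bookkeeping only. Seat ty-1's `WAll/TargetPrimeSlices.lean` (p503270) names the prime × rank
SLICES of three rows of the closed list — row 2 `WAllExclAdditive{AtThree,FiveLe}{,RankZero,RankOne}`,
row 7 `WAllCornerX7{AtThree,FiveLe}`, row 12i `WAllCornerFInertBad{AtThree,FiveLe}` — as
`@[conjecture] def`s whose shapes are VERBATIM the hypotheses of this seat's closers
(`AltClosersAdditiveCells.lean`, `AltClosersResidualCells.lean`) and the lane-3 routes' residual
items, and gate5 LOADED the ten as alt-closer targets of `BirchSwinnertonDyer/BirchSwinnertonDyer`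
(director-bsd 06:18:40Z), so routes may `--closes-target` a slice. This file is the glue in both
directions, so that the kernel tracks W-ALL at slice granularity:

§1 **each slice FROM THE REGISTERED RUNG LEAVES, by name** (one-line re-keyings of the landed
closers, now concluding ty-1's NAMED slices by `defeq`):
* `wAllExclAdditiveAtThree_of_leaves` ⇐ K1 `Additive.AdditiveOrdinaryLowerHalf` + the `p = 3` upper
  half `hUp3` + K8 `O5SharpGss` + K9t `O5SharpTprime` + K9w `O6Sharp` + GZK
  (`exclAdditiveAtThree_of_leaves`);
* `wAllExclAdditiveFiveLeRankZero_of_leaves` ⇐ `Additive.N10.LowerHalf` (the rank-0 half of K1) +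
  `hUp0` + K8 + K9t + GZK (`exclAdditiveRankZero_of_leaves`); `wAllExclAdditiveFiveLeRankOne_of_leaves`
  ⇐ `Additive.O7.LowerHalf` + `hUp1` + K8 + K9t + GZK (`exclAdditiveRankOne_of_leaves`);
  `wAllExclAdditiveFiveLe_of_leaves` = both;
* `wAllCornerX7AtThree_of_signedSupersingular` / `wAllCornerX7FiveLe_of_signedSupersingular` ⇐ LEAF
  K3 `Supersingular.SignedSupersingular` + Wuthrich + GZK + modularity; `wAllCornerX7FiveLe_of_kobayashiMC`
  ⇐ Kobayashi's main conjecture (some sign) on class X7 at `p ≥ 5` + PUB (`cornerX7_fiveLe_of_kobayashiMC`),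
  `wAllCornerX7FiveLe_of_surjKobayashiMC_of_smallImage` ⇐ the `SignedBaseChange` route's purchase
  (Surj cell, KMC currency) + item 19002 `KobayashiMainConjectureSmallImage` (verbatim) + PUB;
* `wAllCornerFInertBadAtThree_of_inertBadAtThree` ⇐ item 19225 `InertBadAtThree` (verbatim,
  `X12.MissingInputAt` currency) + Li–Liu–Tian 2024 + GZK; `…AtThree_of_cmInertBad` /
  `wAllCornerFInertBadFiveLe_of_cmInertBad` ⇐ LEAF K8-CM `X12.CMInertBad` + LLT + GZK.

§2 **the closed list, W-ALL and its leading-term form FROM THE SLICE LEAVES** —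
`wAllExclusions_of_sliceLeaves` (rows 2 / 7 / 12i fed by the eight finest slices through ty-1's
`rows_of_primeSlices`; every other row as in `wAllExclusions_of_leaves`; Li–Liu–Tian is no longer a
hypothesis of this step), `wAll_of_sliceLeaves_primaryGZ` (+ the FIFTEEN named facts of
`wAll_of_leaves_primaryGZ`, the Gross–Zagier side primary, `hGZK` fed from its road of record,
`hmod` derived), `wAll_of_sliceLeaves_yanZhuImForm_primaryGZ` (FOURTEEN facts),
`wAllFormula_of_sliceLeaves_primaryGZ` (+ the single sign binder `hL0`). The converse (every slice
from `WAll`) is ty-1's `primeSlices_of_wAll`.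

COUNTS: `wAllExclusions_of_sliceLeaves` has 20 leaf / slice / target / residual hypotheses + 3 print
binders (`hW`, `hmod`, `hGZK`); `wAll_of_sliceLeaves_primaryGZ` 20 + `hW` + 15 facts = 36 names. Of
the 20, the H21 audit reads as UNREGISTERED today only `hX11a` (`X11a.Target`); the additive upper
halves `hUp*` no longer appear at this level (they sit inside the row-2 slices). No census number
moves; typed ≠ proved ≠ endorsed; BSD is not proved by any of this.

References: `WAll/TargetPrimeSlices.lean` (ty-1 g3, p503270); `WAll/AltClosersGlue.lean`,
`WAll/AltClosersGluePrimaryGZ.lean` (p503103), `WAll/AltClosersAdditiveCells.lean` (p496412),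
`WAll/AltClosersResidualCells.lean` (p498853); HOME/INBOX 2026-08-27T06:18:40Z (gate5 closerlists
LOADED); WALL-BRIEF-v1.md §2; [cite: Darmon2004, Thm. 3.22 and §3.9]; [cite: Miller2011LMS, §1 and
Def. 1.1].
-/

noncomputable section

open scoped Classical

open WeierstrassCurve Literature.NumberTheory.EllipticCurves
  Literature.NumberTheory.EllipticCurves.Rank1Residual
  Literature.NumberTheory.EllipticCurves.Rank1Residual.Typed
  Literature.NumberTheory.EllipticCurves.Wuthrich2014
  Literature.NumberTheory.EllipticCurves.ModularForms

set_option autoImplicit false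

namespace Summit.BirchSwinnertonDyer.Rank1Residual.WAll

open Summit.BirchSwinnertonDyer
open Summit.BirchSwinnertonDyer.BirchSwinnertonDyer.Rank1Residual (NonCMAtTwo BSDpOnClassX9)
open Summit.BirchSwinnertonDyer.Rank1Residual.Supersingular (KobayashiMainConjecture)

/-! ## §1 The slices of rows 2 / 7 / 12i from the registered rung leaves, by name -/

/-- **Row 2 at `p = 3` ⇐ K1 + the `p = 3` upper half + K8 + K9t + K9w + GZK**
(`exclAdditiveAtThree_of_leaves`, now concluding ty-1's named slice). [folklore] -/
theorem wAllExclAdditiveAtThree_of_leaves (hK1 : Additive.AdditiveOrdinaryLowerHalf)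
    (hUp3 : ∀ (W : WeierstrassCurve ℚ) [W.IsElliptic] [W.IsGloballyMinimal],
      W.analyticRank ≤ 1 → Additive.N10.Locus W 3 → MissingUpperBoundAt W 3)
    (hK8 : Additive.O5SharpGss) (hK9t : Additive.O5SharpTprime) (hK9w : Additive.O6Sharp)
    (hGZK : rank_eq_analyticRank_of_analyticRank_le_one) : WAllExclAdditiveAtThree :=
  exclAdditiveAtThree_of_leaves hK1 hUp3 hK8 hK9t hK9w hGZK

/-- **Row 2 at `p ≥ 5`, rank `0` ⇐ the rank-0 half of K1 on the N10 locus + the rank-0 upper half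
+ K8 + K9t + GZK** (`exclAdditiveRankZero_of_leaves`; the wild leaf is not needed: `ClassO6 ⇒ p = 3`).
[folklore] -/
theorem wAllExclAdditiveFiveLeRankZero_of_leaves (hN10 : Additive.N10.LowerHalf)
    (hUp0 : ∀ (W : WeierstrassCurve ℚ) [W.IsElliptic] [W.IsGloballyMinimal] (p : ℕ) [Fact p.Prime],
      W.analyticRank = 0 → 5 ≤ p → Additive.N10.Locus W p → MissingUpperBoundAt W p)
    (hK8 : Additive.O5SharpGss) (hK9t : Additive.O5SharpTprime)
    (hGZK : rank_eq_analyticRank_of_analyticRank_le_one) : WAllExclAdditiveFiveLeRankZero :=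
  exclAdditiveRankZero_of_leaves hN10 hUp0 hK8 hK9t hGZK

/-- **Row 2 at `p ≥ 5`, rank `1` ⇐ the rank-1 half `Additive.O7.LowerHalf` + the rank-1 upper half
+ K8 + K9t + GZK** (`exclAdditiveRankOne_of_leaves`). [folklore] -/
theorem wAllExclAdditiveFiveLeRankOne_of_leaves (hO7 : Additive.O7.LowerHalf)
    (hUp1 : ∀ (W : WeierstrassCurve ℚ) [W.IsElliptic] [W.IsGloballyMinimal] (p : ℕ) [Fact p.Prime],
      W.analyticRank = 1 → 5 ≤ p → Additive.N10.Locus W p → MissingUpperBoundAt W p)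
    (hK8 : Additive.O5SharpGss) (hK9t : Additive.O5SharpTprime)
    (hGZK : rank_eq_analyticRank_of_analyticRank_le_one) : WAllExclAdditiveFiveLeRankOne :=
  exclAdditiveRankOne_of_leaves hO7 hUp1 hK8 hK9t hGZK

/-- **Row 2 at `p ≥ 5` ⇐ its two rank slices from the leaves.** [folklore] -/
theorem wAllExclAdditiveFiveLe_of_leaves (hN10 : Additive.N10.LowerHalf) (hO7 : Additive.O7.LowerHalf)
    (hUp0 : ∀ (W : WeierstrassCurve ℚ) [W.IsElliptic] [W.IsGloballyMinimal] (p : ℕ) [Fact p.Prime],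
      W.analyticRank = 0 → 5 ≤ p → Additive.N10.Locus W p → MissingUpperBoundAt W p)
    (hUp1 : ∀ (W : WeierstrassCurve ℚ) [W.IsElliptic] [W.IsGloballyMinimal] (p : ℕ) [Fact p.Prime],
      W.analyticRank = 1 → 5 ≤ p → Additive.N10.Locus W p → MissingUpperBoundAt W p)
    (hK8 : Additive.O5SharpGss) (hK9t : Additive.O5SharpTprime)
    (hGZK : rank_eq_analyticRank_of_analyticRank_le_one) : WAllExclAdditiveFiveLe :=
  wAllExclAdditiveFiveLe_iff_ranks.mpr ⟨wAllExclAdditiveFiveLeRankZero_of_leaves hN10 hUp0 hK8 hK9t hGZK,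
    wAllExclAdditiveFiveLeRankOne_of_leaves hO7 hUp1 hK8 hK9t hGZK⟩

/-- **Row 7 at `p = 3` ⇐ LEAF K3 `Supersingular.SignedSupersingular`** + Wuthrich + GZK + modularity
(`cornerX7AtThree_of_signedSupersingular`). [folklore] -/
theorem wAllCornerX7AtThree_of_signedSupersingular (hK3 : Supersingular.SignedSupersingular)
    (hW : sha_dvd_analyticSha) (hGZK : rank_eq_analyticRank_of_analyticRank_le_one)
    (hmod : hasEntireLFunction_rat) : WAllCornerX7AtThree :=
  cornerX7AtThree_of_signedSupersingular hK3 hW hGZK hmod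

/-- **Row 7 at `p ≥ 5` ⇐ LEAF K3** + Wuthrich + GZK + modularity (the `p ≥ 5` slice of
`wallCornerX7_of_signedSupersingular`). [folklore] -/
theorem wAllCornerX7FiveLe_of_signedSupersingular (hK3 : Supersingular.SignedSupersingular)
    (hW : sha_dvd_analyticSha) (hGZK : rank_eq_analyticRank_of_analyticRank_le_one)
    (hmod : hasEntireLFunction_rat) : WAllCornerX7FiveLe :=
  (wAllCornerX7_iff_three_fiveLe.mp (wallCornerX7_of_signedSupersingular hK3 hW hGZK hmod)).2

/-- **Row 7 at `p ≥ 5` ⇐ Kobayashi's main conjecture (some sign) on class X7 at `p ≥ 5`** + PUB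
`h12` Kobayashi 2003 Thm 1.2 · `hKim` B. D. Kim 2013 Cor 3.15 · `hA5` BKO 2024 Cor A.5 · modularity ·
GZK (`cornerX7_fiveLe_of_kobayashiMC`; `a_p = 0` by Hasse, Pollack a tree theorem). [folklore] -/
theorem wAllCornerX7FiveLe_of_kobayashiMC
    (hMC : ∀ (W : WeierstrassCurve ℚ) [W.IsElliptic] [W.IsGloballyMinimal] (p : ℕ) [Fact p.Prime],
      5 ≤ p → ¬ W.HasCM → ClassX7 W p → ∃ ε : ℤˣ, KobayashiMainConjecture W p ε)
    (h12 : Kobayashi2003.thm12_signedSelmerDual_finite_torsion)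
    (hKim : BDKim2013.cor315_signedCharValue_rankZero)
    (hA5 : BurungaleKobayashiOta2024.corA5_pPart_of_signedCharIdeal_eq)
    (hmodP : nonempty_modularParametrizationData) (hmod : hasEntireLFunction_rat)
    (hGZK : rank_eq_analyticRank_of_analyticRank_le_one) : WAllCornerX7FiveLe :=
  cornerX7_fiveLe_of_kobayashiMC hMC h12 hKim hA5 hmodP hmod hGZK

/-- **Row 7 at `p ≥ 5` ⇐ the `SignedBaseChange` route's purchase (KMC on the surjective cell) +
item 19002 `KobayashiMainConjectureSmallImage` (verbatim) + PUB** — the slice that route would close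
outright if re-targeted at `WAllCornerX7FiveLe`. [folklore] -/
theorem wAllCornerX7FiveLe_of_surjKobayashiMC_of_smallImage
    (hSurj : ∀ (W : WeierstrassCurve ℚ) [W.IsElliptic] [W.IsGloballyMinimal] (p : ℕ) [Fact p.Prime],
      5 ≤ p → ClassX7 W p → Surj W p → ∃ ε : ℤˣ, KobayashiMainConjecture W p ε)
    (hSmall : ∀ (W : WeierstrassCurve ℚ) [W.IsElliptic] [W.IsGloballyMinimal] (p : ℕ) [Fact p.Prime],
      p ≠ 2 → ClassX7 W p → ¬ W.HasCM → W.frobeniusTrace p = 0 → ¬ Surj W p →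
        ∃ ε : ℤˣ, KobayashiMainConjecture W p ε)
    (h12 : Kobayashi2003.thm12_signedSelmerDual_finite_torsion)
    (hKim : BDKim2013.cor315_signedCharValue_rankZero)
    (hA5 : BurungaleKobayashiOta2024.corA5_pPart_of_signedCharIdeal_eq)
    (hmodP : nonempty_modularParametrizationData) (hmod : hasEntireLFunction_rat)
    (hGZK : rank_eq_analyticRank_of_analyticRank_le_one) : WAllCornerX7FiveLe :=
  cornerX7_fiveLe_of_kobayashiMC (kobayashiMC_classX7_fiveLe_of_surj_of_smallImage hSurj hSmall) h12
    hKim hA5 hmodP hmod hGZK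

/-- **Row 12i at `p = 3` ⇐ item 19225 `InertBadAtThree`** (verbatim, `X12.MissingInputAt` currency;
shared by routes `InertBadSignedBranches` / `BiquadraticEisensteinDescent`) + Li–Liu–Tian 2024 + GZK
(`cornerFInertBad_three_of_inertBadAtThree`). [folklore] -/
theorem wAllCornerFInertBadAtThree_of_inertBadAtThree
    (hLLT : LiLiuTian2024.thm11_bsdp_of_cm_rank_one)
    (hGZK : rank_eq_analyticRank_of_analyticRank_le_one)
    (h3 : ∀ (W : WeierstrassCurve ℚ) [W.IsElliptic] [W.IsGloballyMinimal] [Fact (Nat.Prime 3)],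
      W.HasCM → W.analyticRank = 1 → CMInert W 3 → ¬ Good W 3 → X12.MissingInputAt W 3) :
    WAllCornerFInertBadAtThree :=
  cornerFInertBad_three_of_inertBadAtThree hLLT hGZK h3

/-- **Row 12i at `p = 3` ⇐ LEAF K8-CM `X12.CMInertBad`** + LLT + GZK. [folklore] -/
theorem wAllCornerFInertBadAtThree_of_cmInertBad (hLLT : LiLiuTian2024.thm11_bsdp_of_cm_rank_one)
    (hGZK : rank_eq_analyticRank_of_analyticRank_le_one) (hIn : X12.CMInertBad) :
    WAllCornerFInertBadAtThree :=
  cornerFInertBad_three_of_inertBadAtThree hLLT hGZK (inertBadAtThree_of_cmInertBad hIn)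

/-- **Row 12i at `p ≥ 5` ⇐ LEAF K8-CM `X12.CMInertBad`** + LLT + GZK (the `p ≥ 5` slice of
`wallCornerFInertBad_of_cmInertBad`). [folklore] -/
theorem wAllCornerFInertBadFiveLe_of_cmInertBad (hLLT : LiLiuTian2024.thm11_bsdp_of_cm_rank_one)
    (hGZK : rank_eq_analyticRank_of_analyticRank_le_one) (hIn : X12.CMInertBad) :
    WAllCornerFInertBadFiveLe :=
  (wAllCornerFInertBad_iff_three_fiveLe.mp (wallCornerFInertBad_of_cmInertBad hLLT hGZK hIn)).2

/-! ## §2 The closed list, W-ALL and its leading-term form from the SLICE leaves -/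

/-- **THE CLOSED LIST FROM THE SLICE LEAVES.** `WAllExclusions` with rows 2 / 7 / 12i fed by the
eight finest registered slices (ty-1's `rows_of_primeSlices`), rows 1, 3, 4–6, 8–11, 12 (two / ram)
as in `wAllExclusions_of_leaves`: K4 `NonCMAtTwo`, K2a/K2b, K5 `EisensteinPrimes`, K3
`SignedSupersingular` (rows 6 and 8), K6 `BSDpOnClassX9`, the typed targets X10b / X11a, ty-1's
`WAllCornerFTwo` / `WAllCornerFRamified`; print binders `hW`, `hmod`, `hGZK`. [folklore] -/
theorem wAllExclusions_of_sliceLeaves (h5 : NonCMAtTwo)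
    (h30 : WAllExclAdditiveAtThreeRankZero) (h31 : WAllExclAdditiveAtThreeRankOne)
    (h50 : WAllExclAdditiveFiveLeRankZero) (h51 : WAllExclAdditiveFiveLeRankOne)
    (hK2a : X11b.MultiplicativeRankOne) (hK2b : X11b.MultiplicativeRankOneAtThree)
    (hK5 : Eisenstein.EisensteinPrimes) (hK3 : Supersingular.SignedSupersingular)
    (h73 : WAllCornerX7AtThree) (h75 : WAllCornerX7FiveLe)
    (hK6 : BSDpOnClassX9) (hX10b : X10.BSDpOnClassX10b) (hX11a : X11a.Target)
    (hF3 : WAllCornerFInertBadAtThree) (hF5 : WAllCornerFInertBadFiveLe)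
    (hF2 : WAllCornerFTwo) (hFr : WAllCornerFRamified)
    (hW : sha_dvd_analyticSha) (hmod : hasEntireLFunction_rat)
    (hGZK : rank_eq_analyticRank_of_analyticRank_le_one) : WAllExclusions := by
  obtain ⟨hX1, hX2, hX2c⟩ := wallEisenstein_of_eisensteinPrimes hK5
  obtain ⟨hAdd, hX7, hFi⟩ := rows_of_primeSlices h30 h31 h50 h51 h73 h75 hF3 hF5
  exact ⟨h5, hAdd, wAllExclMultRankOne_iff.mpr ⟨wallExclX11b_of_rungK2 hK2a hK2b, hX2c⟩, hX1, hX2,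
    wallCornerX6r0_of_signedSupersingular hK3 hW hGZK hmod, hX7,
    wallCornerX8_of_signedSupersingular hK3 hW hGZK hmod, wallCornerX9_of_bsdpOnClassX9 hmod hGZK hK6,
    wallCornerX10b_of_bsdpOnClassX10b hX10b, wallCornerX11a_of_x11aTarget hX11a,
    wAllCornerF_iff.mpr ⟨hF2, hFr, hFi⟩⟩

/-- **W-ALL FROM THE SLICE LEAVES, FIFTEEN named facts, the Gross–Zagier side primary**
(`wAll_of_exclusions_primaryGZ ∘ wAllExclusions_of_sliceLeaves`; `hmod` derived from `hmodP`,
`hGZK` fed from its road of record). [cite: Darmon2004, Thm. 3.22 and §3.9] -/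
theorem wAll_of_sliceLeaves_primaryGZ (h5 : NonCMAtTwo)
    (h30 : WAllExclAdditiveAtThreeRankZero) (h31 : WAllExclAdditiveAtThreeRankOne)
    (h50 : WAllExclAdditiveFiveLeRankZero) (h51 : WAllExclAdditiveFiveLeRankOne)
    (hK2a : X11b.MultiplicativeRankOne) (hK2b : X11b.MultiplicativeRankOneAtThree)
    (hK5 : Eisenstein.EisensteinPrimes) (hK3 : Supersingular.SignedSupersingular)
    (h73 : WAllCornerX7AtThree) (h75 : WAllCornerX7FiveLe)
    (hK6 : BSDpOnClassX9) (hX10b : X10.BSDpOnClassX10b) (hX11a : X11a.Target)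
    (hF3 : WAllCornerFInertBadAtThree) (hF5 : WAllCornerFInertBadFiveLe)
    (hF2 : WAllCornerFTwo) (hFr : WAllCornerFRamified)
    (hW : sha_dvd_analyticSha)
    (hSk : Skinner2016.thmC_padicValRat_bsd_rank_zero)
    (hBCS : BurungaleCastellaSkinner2025.cor131_padicValRat_bsd_rank_le_one)
    (hJSW : JetchevSkinnerWan2017.thm121_padicValRat_bsd_rank_one)
    (hCGS : CastellaGrossiSkinner2025.thmD_padicValRat_bsd_rank_le_one)
    (hGV : GreenbergVatsal2000.thm13_charIdeal_eq_of_gvPar) (hGr : greenberg_charValue_rankZero)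
    (hmodP : nonempty_modularParametrizationData)
    (hWa : waldspurger_exists_heegnerField_twist_ne_zero)
    (hMM : murtyMurty_exists_heegnerField_twist_simpleZero)
    (hGZ : ∀ (N : ℕ) [NeZero N] (W : WeierstrassCurve ℚ) (K : Type) [Field K] [NumberField K],
      gross_zagier N W K)
    (hKo : ∀ (N : ℕ) [NeZero N] (W : WeierstrassCurve ℚ) (K : Type) [Field K] [NumberField K],
      kolyvagin N W K)
    (hCM : bsdTriple_of_hasCM_of_L_one_ne_zero) (hKob : Kobayashi2013.cor14_bsdp_of_cm_rank_one)
    (hYZ : YanZhu2026.thm415_padicValRat_bsd_rank_le_one)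
    (hLLT : LiLiuTian2024.thm11_bsdp_of_cm_rank_one) : WAll :=
  wAll_of_exclusions_primaryGZ
    (wAllExclusions_of_sliceLeaves h5 h30 h31 h50 h51 hK2a hK2b hK5 hK3 h73 h75 hK6 hX10b hX11a hF3 hF5
      hF2 hFr hW (X2.ClassClosureEntireFree.hasEntireLFunction_rat_of_nonempty_modularParametrizationData hmodP)
      (rank_eq_analyticRank_of_analyticRank_le_one_of_nonempty_modularParametrizationData hmodP hWa
        hMM hGZ hKo))
    hSk hBCS hJSW hCGS hGV hGr hmodP hWa hMM hGZ hKo hCM hKob hYZ hLLT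

/-- **W-ALL FROM THE SLICE LEAVES, FOURTEEN named facts** (the Yan–Zhu (Im) kernel: no `hBCS`, `hYZ`
in printed (Im) form), the Gross–Zagier side primary. [cite: Darmon2004, Thm. 3.22 and §3.9] -/
theorem wAll_of_sliceLeaves_yanZhuImForm_primaryGZ (h5 : NonCMAtTwo)
    (h30 : WAllExclAdditiveAtThreeRankZero) (h31 : WAllExclAdditiveAtThreeRankOne)
    (h50 : WAllExclAdditiveFiveLeRankZero) (h51 : WAllExclAdditiveFiveLeRankOne)
    (hK2a : X11b.MultiplicativeRankOne) (hK2b : X11b.MultiplicativeRankOneAtThree)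
    (hK5 : Eisenstein.EisensteinPrimes) (hK3 : Supersingular.SignedSupersingular)
    (h73 : WAllCornerX7AtThree) (h75 : WAllCornerX7FiveLe)
    (hK6 : BSDpOnClassX9) (hX10b : X10.BSDpOnClassX10b) (hX11a : X11a.Target)
    (hF3 : WAllCornerFInertBadAtThree) (hF5 : WAllCornerFInertBadFiveLe)
    (hF2 : WAllCornerFTwo) (hFr : WAllCornerFRamified)
    (hW : sha_dvd_analyticSha)
    (hSk : Skinner2016.thmC_padicValRat_bsd_rank_zero)
    (hJSW : JetchevSkinnerWan2017.thm121_padicValRat_bsd_rank_one)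
    (hCGS : CastellaGrossiSkinner2025.thmD_padicValRat_bsd_rank_le_one)
    (hGV : GreenbergVatsal2000.thm13_charIdeal_eq_of_gvPar) (hGr : greenberg_charValue_rankZero)
    (hmodP : nonempty_modularParametrizationData)
    (hWa : waldspurger_exists_heegnerField_twist_ne_zero)
    (hMM : murtyMurty_exists_heegnerField_twist_simpleZero)
    (hGZ : ∀ (N : ℕ) [NeZero N] (W : WeierstrassCurve ℚ) (K : Type) [Field K] [NumberField K],
      gross_zagier N W K)
    (hKo : ∀ (N : ℕ) [NeZero N] (W : WeierstrassCurve ℚ) (K : Type) [Field K] [NumberField K],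
      kolyvagin N W K)
    (hCM : bsdTriple_of_hasCM_of_L_one_ne_zero) (hKob : Kobayashi2013.cor14_bsdp_of_cm_rank_one)
    (hYZ : YanZhu2026.thm415_padicValRat_bsd_rank_le_one_of_bigIm)
    (hLLT : LiLiuTian2024.thm11_bsdp_of_cm_rank_one) : WAll :=
  wAll_of_exclusions_yanZhuImForm
    (wAllExclusions_of_sliceLeaves h5 h30 h31 h50 h51 hK2a hK2b hK5 hK3 h73 h75 hK6 hX10b hX11a hF3 hF5
      hF2 hFr hW (X2.ClassClosureEntireFree.hasEntireLFunction_rat_of_nonempty_modularParametrizationData hmodP)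
      (rank_eq_analyticRank_of_analyticRank_le_one_of_nonempty_modularParametrizationData hmodP hWa
        hMM hGZ hKo))
    hSk hJSW hCGS hGV hGr hmodP
    (rank_eq_analyticRank_of_analyticRank_le_one_of_nonempty_modularParametrizationData hmodP hWa hMM
      hGZ hKo)
    hCM hKob hYZ hLLT

/-- **THE FULL BSD FORMULA FOR EVERY `E/ℚ` OF ANALYTIC RANK `≤ 1`, FROM THE SLICE LEAVES**,
FIFTEEN named facts and ONE sign binder `hL0` (`wAllFormula_of_wAll_oneSign ∘
wAll_of_sliceLeaves_primaryGZ`). [cite: GrossZagier1986, Thm. V.(2.1) (p. 311) and V.§2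
(pp. 312–313)] [cite: Darmon2004, Thm. 3.22 and §3.9] -/
theorem wAllFormula_of_sliceLeaves_primaryGZ (h5 : NonCMAtTwo)
    (h30 : WAllExclAdditiveAtThreeRankZero) (h31 : WAllExclAdditiveAtThreeRankOne)
    (h50 : WAllExclAdditiveFiveLeRankZero) (h51 : WAllExclAdditiveFiveLeRankOne)
    (hK2a : X11b.MultiplicativeRankOne) (hK2b : X11b.MultiplicativeRankOneAtThree)
    (hK5 : Eisenstein.EisensteinPrimes) (hK3 : Supersingular.SignedSupersingular)
    (h73 : WAllCornerX7AtThree) (h75 : WAllCornerX7FiveLe)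
    (hK6 : BSDpOnClassX9) (hX10b : X10.BSDpOnClassX10b) (hX11a : X11a.Target)
    (hF3 : WAllCornerFInertBadAtThree) (hF5 : WAllCornerFInertBadFiveLe)
    (hF2 : WAllCornerFTwo) (hFr : WAllCornerFRamified)
    (hW : sha_dvd_analyticSha)
    (hSk : Skinner2016.thmC_padicValRat_bsd_rank_zero)
    (hBCS : BurungaleCastellaSkinner2025.cor131_padicValRat_bsd_rank_le_one)
    (hJSW : JetchevSkinnerWan2017.thm121_padicValRat_bsd_rank_one)
    (hCGS : CastellaGrossiSkinner2025.thmD_padicValRat_bsd_rank_le_one)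
    (hGV : GreenbergVatsal2000.thm13_charIdeal_eq_of_gvPar) (hGr : greenberg_charValue_rankZero)
    (hmodP : nonempty_modularParametrizationData)
    (hWa : waldspurger_exists_heegnerField_twist_ne_zero)
    (hMM : murtyMurty_exists_heegnerField_twist_simpleZero)
    (hGZ : ∀ (N : ℕ) [NeZero N] (W : WeierstrassCurve ℚ) (K : Type) [Field K] [NumberField K],
      gross_zagier N W K)
    (hKo : ∀ (N : ℕ) [NeZero N] (W : WeierstrassCurve ℚ) (K : Type) [Field K] [NumberField K],
      kolyvagin N W K)
    (hCM : bsdTriple_of_hasCM_of_L_one_ne_zero) (hKob : Kobayashi2013.cor14_bsdp_of_cm_rank_one)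
    (hYZ : YanZhu2026.thm415_padicValRat_bsd_rank_le_one)
    (hLLT : LiLiuTian2024.thm11_bsdp_of_cm_rank_one)
    (hL0 : re_entireLFunction_one_nonneg) : WAllFormula :=
  wAllFormula_of_wAll_oneSign hmodP hL0 hWa hGZ
    (wAll_of_sliceLeaves_primaryGZ h5 h30 h31 h50 h51 hK2a hK2b hK5 hK3 h73 h75 hK6 hX10b hX11a hF3 hF5
      hF2 hFr hW hSk hBCS hJSW hCGS hGV hGr hmodP hWa hMM hGZ hKo hCM hKob hYZ hLLT)

end Summit.BirchSwinnertonDyer.Rank1Residual.WAll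

end
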